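import Mathlib
import Summits.Ventures.PercRepro2.TwoHullMasterBlocks

/-!
# The cube-block principle for the RIGID two-hull master statement (blind cell PercRepro2,
night-4 g40, 2026-08-29; proofs/NIGHT4-G40.md §5)

The rigid form `TwoHullMasterRigid` (TwoHullMaster.lean) takes the edge pair
`(redEdges, blueEdges)` of `h` — the red edges inside its red cluster, the blue edges inside its
blue cluster — in place of its hull pair; it gives the lane's rigid row 2′SW-ALL
(`swAll_of_twoHullMasterRigid`).  This file repeats the cube-block principle for it: the signed
summand `phiGE`, the four-count identity `sum_phiGE_eq`, `twoHullMasterRigid_of_sum_nonpos`; a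
RIGID CUBE BLOCK (`CubeBlockRigid`: the hull pair of `l` monotone, the EDGE pair of `h` antitone,
the antipode mirroring the hull pair of `l` or the edge pair of `h`), its inequality
`CubeBlockRigid.sum_phiGE_nonpos` (Mathlib's FKG on the cube), `CubeCoverRigid` and
**`twoHullMasterRigid_of_cubeCoverRigid`**.  The census (mining/night-4/g40/rigidcube.py): the
vertex cover of the prism is NOT rigid (5 of its 9 blocks fail the edge-pair antitonicity), but a
rigid σ-symmetric cover with 10 blocks exists — TwoHullMasterPrismRigid.lean.
-/

namespace Summit.Ventures.PercRepro2

namespace Blocks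

open Hull LocRows Path2 Glue2

open scoped Classical

variable {V : Type*} {E : Type*}

/-! ## §1 The rigid signed sums -/

section Generic

variable [Fintype E] [DecidableEq E] (ends : E → Sym2 V)

/-- The rigid signed summand `X·Y`: the sign of the hull pair of `l` times the sign of the edge pair
of `h`. -/
noncomputable def phiGE (l h : V) (𝓦l : Set (Set V × Set V)) (𝓦h : Set (Set E × Set E))
    (ζ : Config E) : ℤ :=
  sgn 𝓦l (hullPair ends ζ l) * sgn 𝓦h (edgePair ends ζ h)

variable {ends}

/-- The rigid two-hull class is `uClass` filtered by the pairs. -/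
lemma twoHullClassE_eq_uClass_filter (l h : V) (𝓦l : Set (Set V × Set V))
    (𝓦h : Set (Set E × Set E)) :
    twoHullClassE ends l h 𝓦l 𝓦h =
      (uClass ends l h).filter fun ζ => hullPair ends ζ l ∈ 𝓦l ∧ edgePair ends ζ h ∈ 𝓦h := by
  ext ζ
  rw [mem_twoHullClassE, Finset.mem_filter, mem_uClass]

/-- The rigid signed sum in terms of the four rigid two-hull counts. -/
lemma sum_phiGE_eq (l h : V) (𝓦l : Set (Set V × Set V)) (𝓦h : Set (Set E × Set E)) :
    ∑ ζ ∈ uClass ends l h, phiGE ends l h 𝓦l 𝓦h ζ =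
      ((twoHullClassE ends l h 𝓦l 𝓦h).card : ℤ)
        - ((twoHullClassE ends l h 𝓦l (mirror 𝓦h)).card : ℤ)
        - ((twoHullClassE ends l h (mirror 𝓦l) 𝓦h).card : ℤ)
        + ((twoHullClassE ends l h (mirror 𝓦l) (mirror 𝓦h)).card : ℤ) := by
  have key : ∀ ζ, phiGE ends l h 𝓦l 𝓦h ζ =
      (if (hullPair ends ζ l ∈ 𝓦l ∧ edgePair ends ζ h ∈ 𝓦h) then (1 : ℤ) else 0)
      - (if (hullPair ends ζ l ∈ 𝓦l ∧ edgePair ends ζ h ∈ mirror 𝓦h) then (1 : ℤ) else 0)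
      - (if (hullPair ends ζ l ∈ mirror 𝓦l ∧ edgePair ends ζ h ∈ 𝓦h) then (1 : ℤ) else 0)
      + (if (hullPair ends ζ l ∈ mirror 𝓦l ∧ edgePair ends ζ h ∈ mirror 𝓦h) then (1 : ℤ)
          else 0) := by
    intro ζ
    simp only [phiGE, sgn, ind, mem_mirror, Prod.swap]
    split_ifs <;> simp_all
  simp_rw [key]
  rw [Finset.sum_add_distrib, Finset.sum_sub_distrib, Finset.sum_sub_distrib]
  simp only [Finset.sum_boole, twoHullClassE_eq_uClass_filter]

/-- **The rigid (MM) from the signed sums**: if `Σ_U X·Y ≤ 0` for all up-sets, the rigid (MM)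
holds. -/
theorem twoHullMasterRigid_of_sum_nonpos (l h : V)
    (hs : ∀ (𝓦l : Set (Set V × Set V)) (𝓦h : Set (Set E × Set E)), IsPairUpSet 𝓦l →
      IsPairUpSetE 𝓦h → ∑ ζ ∈ uClass ends l h, phiGE ends l h 𝓦l 𝓦h ζ ≤ 0) :
    TwoHullMasterRigid ends l h := by
  intro 𝓦l 𝓦h h𝓦l h𝓦h
  have hsum := hs 𝓦l 𝓦h h𝓦l h𝓦h
  rw [sum_phiGE_eq] at hsum
  have e1 := card_twoHullClassE_mirror_mirror (ends := ends) l h 𝓦l 𝓦h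
  have e2 := card_twoHullClassE_mirror_mirror (ends := ends) l h 𝓦l (mirror 𝓦h)
  rw [mirror_mirror] at e2
  omega

end Generic

/-! ## §2 Rigid cube blocks -/

/-- **A rigid monotone cube block**: an injective map from the cube into `U` along which the hull
pair of `l` is monotone and the edge pair of `h` antitone, mirroring the hull pair of `l` or the
edge pair of `h` at the antipode. -/
structure CubeBlockRigid (ends : E → Sym2 V) (l h : V) {ι : Type*}
    (pt : (ι → Bool) → Config E) : Prop where
  /-- The points of the block are distinct configurations. -/
  inj : Function.Injective pt
  /-- Every point lies in `U`. -/
  mem : ∀ ε, h ∉ hull ends (pt ε) l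
  /-- The hull pair of `l` is monotone along the cube. -/
  l_mono : ∀ ⦃ε ε' : ι → Bool⦄, ε ≤ ε' → PairLE (hullPair ends (pt ε) l) (hullPair ends (pt ε') l)
  /-- The edge pair of `h` is antitone along the cube. -/
  h_anti : ∀ ⦃ε ε' : ι → Bool⦄, ε ≤ ε' → PairLE (edgePair ends (pt ε') h) (edgePair ends (pt ε) h)
  /-- The antipode mirrors the hull pair of `l`, or the edge pair of `h`. -/
  mirror : (∀ ε, hullPair ends (pt (cubeNot ε)) l = (hullPair ends (pt ε) l).swap) ∨
    (∀ ε, edgePair ends (pt (cubeNot ε)) h = (edgePair ends (pt ε) h).swap)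

variable {ends : E → Sym2 V} {l h : V} {ι : Type*} {pt : (ι → Bool) → Config E}

/-- **The rigid block inequality.** -/
theorem CubeBlockRigid.sum_phiGE_nonpos [Fintype E] [DecidableEq E] [Fintype ι]
    (hb : CubeBlockRigid ends l h pt) {𝓦l : Set (Set V × Set V)} {𝓦h : Set (Set E × Set E)}
    (h𝓦l : IsPairUpSet 𝓦l) (h𝓦h : IsPairUpSetE 𝓦h) :
    ∑ ε, phiGE ends l h 𝓦l 𝓦h (pt ε) ≤ 0 := by
  set X : (ι → Bool) → ℤ := fun ε => sgn 𝓦l (hullPair ends (pt ε) l) with hX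
  set Y : (ι → Bool) → ℤ := fun ε => sgn 𝓦h (edgePair ends (pt ε) h) with hY
  have hphi : ∀ ε, phiGE ends l h 𝓦l 𝓦h (pt ε) = X ε * Y ε := fun ε => rfl
  simp_rw [hphi]
  have h𝓦h' : IsPairUpSet 𝓦h := h𝓦h
  have hXmono : Monotone X := fun ε ε' hle => sgn_mono h𝓦l (hb.l_mono hle)
  have hYanti : Antitone Y := fun ε ε' hle => sgn_mono h𝓦h' (hb.h_anti hle)
  rcases hb.mirror with hm | hm
  · have hodd : ∀ ε, X (cubeNot ε) = - X ε := by
      intro ε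
      simp only [hX, hm ε, sgn_swap]
    have key := cube_sum_nonpos (fun ε => X (cubeNot ε)) (fun ε => Y (cubeNot ε))
      (fun ε ε' hle => hXmono (cubeNot_le_cubeNot hle))
      (fun ε ε' hle => hYanti (cubeNot_le_cubeNot hle))
      (fun ε => by simp only [cubeNot_cubeNot, hodd ε, neg_neg])
      (fun ε => sgn_le_one _ _) (fun ε => neg_one_le_sgn _ _)
    have hre : ∑ ε, X (cubeNot ε) * Y (cubeNot ε) = ∑ ε, X ε * Y ε :=
      Equiv.sum_comp (cubeNotPerm : Equiv.Perm (ι → Bool)) (fun ε => X ε * Y ε)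
    simpa [hre] using key
  · have hodd : ∀ ε, Y (cubeNot ε) = - Y ε := by
      intro ε
      simp only [hY, hm ε, sgn_swap]
    have key := cube_sum_nonpos Y X hYanti hXmono hodd (fun ε => sgn_le_one _ _)
      (fun ε => neg_one_le_sgn _ _)
    simpa only [mul_comm] using key

/-! ## §3 Rigid cube covers and the theorem -/

/-- **A rigid cube cover of `U`.** -/
structure CubeCoverRigid (ends : E → Sym2 V) (l h : V) {β : Type*} {ι : β → Type*}
    (pt : ∀ b, (ι b → Bool) → Config E) : Prop where
  /-- Every member is a rigid monotone cube block. -/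
  block : ∀ b, CubeBlockRigid ends l h (pt b)
  /-- Every configuration of `U` lies in some block. -/
  cover : ∀ ζ : Config E, h ∉ hull ends ζ l → ∃ b ε, pt b ε = ζ
  /-- Two blocks sharing a configuration are the same block. -/
  disj : ∀ b b' ε ε', pt b ε = pt b' ε' → b = b'

variable {β : Type*} {ιb : β → Type*} {ptb : ∀ b, (ιb b → Bool) → Config E}

/-- `U` is the union of the images of the blocks of a rigid cover. -/
lemma uClass_eq_biUnion_rigid [Fintype E] [DecidableEq E] [Fintype β] [∀ b, Fintype (ιb b)]
    (hc : CubeCoverRigid ends l h ptb) :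
    uClass ends l h = Finset.univ.biUnion fun b => Finset.univ.image (ptb b) := by
  ext ζ
  simp only [mem_uClass, Finset.mem_biUnion, Finset.mem_univ, true_and, Finset.mem_image]
  constructor
  · intro hζ
    exact hc.cover ζ hζ
  · rintro ⟨b, ε, rfl⟩
    exact (hc.block b).mem ε

/-- **The rigid (MM) from a rigid cube cover.** -/
theorem twoHullMasterRigid_of_cubeCoverRigid [Fintype E] [DecidableEq E] [Fintype β]
    [∀ b, Fintype (ιb b)] (hc : CubeCoverRigid ends l h ptb) : TwoHullMasterRigid ends l h := by
  refine twoHullMasterRigid_of_sum_nonpos l h fun 𝓦l 𝓦h h𝓦l h𝓦h => ?_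
  rw [uClass_eq_biUnion_rigid hc]
  rw [Finset.sum_biUnion]
  · refine Finset.sum_nonpos fun b _ => ?_
    rw [Finset.sum_image fun ε _ ε' _ hεε' => (hc.block b).inj hεε']
    exact (hc.block b).sum_phiGE_nonpos h𝓦l h𝓦h
  · intro b _ b' _ hbb'
    rw [Function.onFun, Finset.disjoint_left]
    rintro ζ hζ hζ'
    rw [Finset.mem_image] at hζ hζ'
    obtain ⟨ε, _, rfl⟩ := hζ
    obtain ⟨ε', _, hε'⟩ := hζ'
    exact hbb' (hc.disj b b' ε ε' hε'.symm)

end Blocks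

end Summit.Ventures.PercRepro2
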